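import Summits.QuantumFields.BalabanUV.T4Continuum.Support.NE7AdmissibleFibreLHC
import Summits.QuantumFields.BalabanUV.T4Continuum.Support.AveragingDeficitChartCalculus
import Mathlib.Analysis.Calculus.InverseFunctionTheorem.FDeriv
import Mathlib.Analysis.Calculus.ContDiff.RCLike
import HarnessLib

/-!
# NE7AdmissibleFibreQuantitativeBase — THE QUANTITATIVE ADMISSIBLE FIBRE AT A MOVING BASE POINT OF THE CHART: gen 113's `NE7AdmissibleFibreQuantitative` (linear-rate lower
# hemicontinuity at the chart centre `0`) restated for EVERY base point `b` in a small ball of the torus chart at `U₀` — for every unitary `N`-periodic datum `D` near `D₀` whose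
# `𝔲(n)` coordinate `y(D)` is within `κρ₀` of the coordinate `g(b)` of the average of `chart_{U₀}(b)`, there is `Φ` with `‖Φ − b‖ ≤ ‖y(D) − g(b)‖∕κ`, `chart_{U₀}(Φ)` admissible
# over `D`, and `|A_W(chart Φ) − A_W(chart b)| ≤ C‖Φ − b‖`; moreover `‖g(b)‖ ≤ C_g‖b‖` (Mathlib's `surjOn_closedBall_of_nonlinearRightInverse` allows any centre; the uniform
# constants come from ONE `ApproximatesLinearOn` neighbourhood of `0`) — the form the lower bound of the two-sided Lipschitz estimate of `A_k` consumes (ROAD-G113 §5ter: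
# base point `b = ` the coordinate of the moving minimiser, target `D = D₀`)

Cell `pub-balaban`, rung (B)+1 sub-cell t4, lineage `b2b-balaban-t4-ne7-p1` (CRUX PROVER NE7 #1 = OWNER of BINDER row NE7), generation 113.  Memo
`t4/b2b-balaban-t4-ne7-p1-g113/ROAD-G113.md` §5ter.  Same ingredients as ✓ p819905 (`hasStrictFDerivAt_levelQ` ∕ `levelQ'_onto`, Mathlib's nonlinear right inverse and
`ApproximatesLinearOn`, `contDiffAt_fineAction_chart` + `ContDiffAt.exists_lipschitzOnWith`, decoding `eq_of_skewPR_relLog_eq`).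
WHAT ([folklore]; 0 def, 0 sorry; generic `d`, `L ≥ 1`).  **`chart_fibre_quantitative`** (statement in the theorem's docstring; `g b := levelQ L N k U₀ (chart_id U₀ b)`).
HONEST FRAMING (page 1): soft finite-dimensional calculus; `κ`, `C`, `C_g`, `ρ₀` EXISTENTIAL and NOT uniform in `U₀`, `k`, `N`; nothing is asserted about Bałaban's minimisers; NOT NE7,
NOT NE3; spine 0∕9; finite T⁴ rung (B)+1 — NOT infinite volume, NOT mass gap, NOT BetaPertH, NOT Clay (continuum YM on T⁴ ⇐ BetaPertH ∧ nine spine estimates).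
-/

set_option autoImplicit false

open scoped BigOperators Matrix Matrix.Norms.L2Operator Topology NNReal
open NormedSpace Finset Set Filter Metric

namespace Summit.QuantumFields.BalabanUV.T4Continuum.NE7AdmissibleFibreQuantitativeBase

open Literature.MathematicalPhysics.QuantumFieldTheory.Balaban1983to89
open B7Prop1Explicit B7Prop2Explicit MatrixLog UnitaryModel
open T4AveragingDeficitWall (IsUnitaryCfg IsSkewDir SmallField vary fineAction)
open T4AveragingDeficitWallBoundary (IsPeriodicCfg periodBox)
open AveragingDeficitPeriodicCounting (IsPeriodicDir)
open AveragingDeficitTorusChart (TDir redN chart chartDir chart_zero skewP skewP_of_mem skewP_mem isUnitaryCfg_chart isPeriodicCfg_chart)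
open AveragingDeficitChartCalculus (cavg relLog relLog_self mlog_one contDiffAt_fineAction_chart)
open AveragingDeficitFermat (eventually_smallField_chart)
open AveragingDeficitTwoLevelPrep (skewSub mem_skewSub skewPF skewPR skewPF_of_mem skewPF_apply)
open AveragingDeficitMultiLevelPrep (tower cavgIter levelQ levelQ' levelQ_self LevelSmall cavgIter_unitary_small isPeriodicCfg_cavgIter
  natCast_tower_succ tower_ne_zero)
open AveragingDeficitMultiLevelFermat (hasStrictFDerivAt_levelQ levelQ'_onto continuousAt_cavgIter_chart)
open AveragingDeficitMultiLevelBridge (cavgIter_eq_avgIter tower_eq)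
open MinimalActionSandwich (admissible)
open MinimalActionRate (sfClass)
open NE7AdmissibleFibreLHC (continuous_chart chart_id_eq_chart_skewP eq_of_skewPR_relLog_eq tendsto_skewPR_relLog eventually_near_base period_succ_eq)

noncomputable section

variable {d : ℕ} {n : Type*} [Fintype n] [DecidableEq n]

/-- **THE QUANTITATIVE ADMISSIBLE FIBRE AT A MOVING BASE POINT.**  `L ≥ 1`, `ε ≥ 0`, `LevelSmall d L k (ε(L^{k+1})^{−2})`, `U₀ ∈ admissible (sfClass d L N ε) L (k+1) D₀` interior
(`SmallField U₀ a`, `a < ε(L^{k+1})^{−2}`), `W` a finite window.  THEN `∃ κ > 0, C ≥ 0, C_g ≥ 0, ρ₀ > 0` such that for every chart parameter `b ∈ skewSub (L·tower L N k)` with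
`‖b‖ ≤ ρ₀`: (i) `‖g b‖ ≤ C_g‖b‖` where `g b = levelQ L N k U₀ (chart_id U₀ b)` is the `𝔲(n)` coordinate of `Q̄_{k+1}(chart_id U₀ b)` at `D₀`; (ii) for every unitary `N`-periodic `D`
bondwise within `1∕4` of `D₀` with `‖y(D) − g b‖ ≤ κρ₀`, `y(D) = skewPR N (relLog N D₀ D)`: `∃ Φ`, `‖Φ − b‖ ≤ ‖y(D) − g b‖∕κ`, `chart_id U₀ Φ ∈ admissible (sfClass d L N ε) L (k+1) D`,
`|fineAction (chart_id U₀ Φ) W − fineAction (chart_id U₀ b) W| ≤ C‖Φ − b‖`. [folklore] -/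
theorem chart_fibre_quantitative [Nonempty n] {L N k : ℕ} [NeZero L] [NeZero N] (hL : 1 ≤ L) {ε a : ℝ} (hε : 0 ≤ ε)
    (hls : LevelSmall d L k (ε / ((L : ℝ) ^ (k + 1)) ^ 2)) {D₀ U₀ : Site d → Fin d → (Matrix n n ℂ)ˣ}
    (hU₀ : U₀ ∈ admissible (sfClass d L N ε) L (k + 1) D₀) (haε : a < ε / ((L : ℝ) ^ (k + 1)) ^ 2) (hU₀a : SmallField U₀ a)
    (W : Finset (T4AveragingDeficitWall.Plaq d)) :
    ∃ κ C Cg ρ₀ : ℝ, 0 < κ ∧ 0 ≤ C ∧ 0 ≤ Cg ∧ 0 < ρ₀ ∧ ∀ b : ↥(skewSub d n (L * tower L N k)), ‖b‖ ≤ ρ₀ →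
      ‖levelQ L N k U₀ (chart (ContinuousLinearMap.id ℝ (Matrix n n ℂ)) (L * tower L N k) U₀ (b : TDir d n (L * tower L N k)))‖ ≤ Cg * ‖b‖ ∧
      ∀ D : Site d → Fin d → (Matrix n n ℂ)ˣ, IsUnitaryCfg D → IsPeriodicCfg D (N : ℤ) →
        (∀ (r : Fin d → Fin N) (κ' : Fin d),
          ‖(((D₀ (boxVec N r) κ')⁻¹ : (Matrix n n ℂ)ˣ) : Matrix n n ℂ) * (D (boxVec N r) κ' : Matrix n n ℂ) - 1‖ ≤ 1 / 4) →
        ‖skewPR N (relLog N D₀ D) - levelQ L N k U₀ (chart (ContinuousLinearMap.id ℝ (Matrix n n ℂ)) (L * tower L N k) U₀ (b : TDir d n (L * tower L N k)))‖ ≤ κ * ρ₀ →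
        ∃ Φ : ↥(skewSub d n (L * tower L N k)),
          ‖Φ - b‖ ≤ ‖skewPR N (relLog N D₀ D) - levelQ L N k U₀ (chart (ContinuousLinearMap.id ℝ (Matrix n n ℂ)) (L * tower L N k) U₀ (b : TDir d n (L * tower L N k)))‖ / κ ∧
          chart (ContinuousLinearMap.id ℝ (Matrix n n ℂ)) (L * tower L N k) U₀ (Φ : TDir d n (L * tower L N k)) ∈ admissible (sfClass d L N ε) L (k + 1) D ∧
          |fineAction (chart (ContinuousLinearMap.id ℝ (Matrix n n ℂ)) (L * tower L N k) U₀ (Φ : TDir d n (L * tower L N k))) W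
              - fineAction (chart (ContinuousLinearMap.id ℝ (Matrix n n ℂ)) (L * tower L N k) U₀ (b : TDir d n (L * tower L N k))) W| ≤ C * ‖Φ - b‖ := by
  set M : ℕ := L * tower L N k with hMdef
  set x : ℝ := ε / ((L : ℝ) ^ (k + 1)) ^ 2 with hxdef
  have hx : 0 ≤ x := by rw [hxdef]; positivity
  obtain ⟨⟨hU₀u, hU₀P, hU₀x⟩, hU₀avg⟩ := hU₀
  have eP : ((N * L ^ (k + 1) : ℕ) : ℤ) = (L : ℤ) * (tower L N k : ℕ) := by rw [tower_eq]; push_cast; ring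
  have ePM : ((N * L ^ (k + 1) : ℕ) : ℤ) = (M : ℤ) := by rw [hMdef]; push_cast; rw [tower_eq]; push_cast; ring
  have hU₀P' : IsPeriodicCfg U₀ ((L : ℤ) * (tower L N k : ℕ)) := by rw [← eP]; exact hU₀P
  have hU₀PM : IsPeriodicCfg U₀ (M : ℤ) := by rw [← ePM]; exact hU₀P
  have hcD : cavgIter L (k + 1) U₀ = D₀ := by rw [cavgIter_eq_avgIter]; exact hU₀avg
  have hD₀u : IsUnitaryCfg D₀ := by
    obtain ⟨h, -, -⟩ := cavgIter_unitary_small hL k hU₀u hx hls hU₀x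
    rwa [hcD] at h
  haveI : CompleteSpace ↥(skewSub d n M) := FiniteDimensional.complete ℝ _
  haveI : CompleteSpace ↥(skewSub d n N) := FiniteDimensional.complete ℝ _
  -- the constraint map in the chart and its strict derivative (row NE3-R2), onto
  set g : ↥(skewSub d n M) → ↥(skewSub d n N) := fun Φ =>
    levelQ L N k U₀ (chart (ContinuousLinearMap.id ℝ (Matrix n n ℂ)) M U₀ (Φ : TDir d n M)) with hg
  have hQ := hasStrictFDerivAt_levelQ (d := d) (n := n) (M' := N) hL k hU₀u hU₀P' hx hls hU₀x
  have hι := ((skewSub d n M).subtypeL).hasStrictFDerivAt (x := 0)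
  set f' := (levelQ' L N k U₀).comp (skewSub d n M).subtypeL with hf'
  have hcomp : HasStrictFDerivAt g f' 0 := by
    have h := HasStrictFDerivAt.comp (0 : ↥(skewSub d n M)) (by simpa using hQ) hι
    exact h
  have hrange : f'.range = ⊤ := by
    refine LinearMap.range_eq_top.mpr fun γ => ?_
    obtain ⟨Φ, hΦs, hΦ⟩ := levelQ'_onto (d := d) (n := n) (M' := N) hL k hU₀u hU₀P' hx hls hU₀x γ
    exact ⟨⟨Φ, mem_skewSub.mpr hΦs⟩, by simpa [hf'] using hΦ⟩
  have hg0 : g 0 = 0 := by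
    simp only [hg, Submodule.coe_zero, chart_zero, levelQ_self]
  -- Mathlib's quantitative open mapping
  set f'symm := f'.nonlinearRightInverseOfSurjective hrange with hf'symm
  have hnn : 0 < f'symm.nnnorm := ContinuousLinearMap.nonlinearRightInverseOfSurjective_nnnorm_pos _ hrange
  set c : ℝ≥0 := f'symm.nnnorm⁻¹ / 2 with hc
  have cpos : 0 < c := by simp [hc, inv_pos, hnn]
  obtain ⟨s, hs, happ⟩ := hcomp.approximates_deriv_on_nhds (Or.inr cpos)
  have hκ : (0 : ℝ) < (f'symm.nnnorm : ℝ)⁻¹ - c := by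
    have h1 : ((f'symm.nnnorm : ℝ)⁻¹ - c : ℝ) = (c : ℝ) := by
      simp only [hc, NNReal.coe_div, NNReal.coe_inv, NNReal.coe_ofNat]; ring
    rw [h1]; exact_mod_cast cpos
  set κ : ℝ := (f'symm.nnnorm : ℝ)⁻¹ - c with hκdef
  -- the chart and the action along it
  set ch : ↥(skewSub d n M) → (Site d → Fin d → (Matrix n n ℂ)ˣ) := fun Φ =>
    chart (ContinuousLinearMap.id ℝ (Matrix n n ℂ)) M U₀ (Φ : TDir d n M) with hch
  have hA : ContDiffAt ℝ 1 (fun Φ : ↥(skewSub d n M) => fineAction (ch Φ) W) 0 :=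
    (contDiffAt_fineAction_chart (m := 1) (ContinuousLinearMap.id ℝ (Matrix n n ℂ)) M U₀ W _).comp (0 : ↥(skewSub d n M))
      (skewSub d n M).subtypeL.contDiff.contDiffAt
  obtain ⟨K, t, ht, hLip⟩ := hA.exists_lipschitzOnWith
  -- the good chart parameters: class radius and decoding margin
  have hval0 : Tendsto (fun Φ : ↥(skewSub d n M) => (Φ : TDir d n M)) (𝓝 0) (𝓝 0) := by
    have h := continuous_subtype_val.tendsto (0 : ↥(skewSub d n M))
    rwa [Submodule.coe_zero] at h
  have hV2 : ∀ᶠ Φ : ↥(skewSub d n M) in 𝓝 0, SmallField (ch Φ) x :=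
    hval0.eventually (eventually_smallField_chart (ContinuousLinearMap.id ℝ (Matrix n n ℂ)) M hU₀PM haε hU₀a)
  have hV3' : ∀ᶠ θ : TDir d n M in 𝓝 0, ∀ (r : Fin d → Fin N) (κ' : Fin d),
      ‖(((D₀ (boxVec N r) κ')⁻¹ : (Matrix n n ℂ)ˣ) : Matrix n n ℂ)
        * (cavgIter L (k + 1) (chart (ContinuousLinearMap.id ℝ (Matrix n n ℂ)) M U₀ θ) (boxVec N r) κ' : Matrix n n ℂ) - 1‖ ≤ 1 / 4 := by
    refine Filter.eventually_all.mpr fun r => Filter.eventually_all.mpr fun κ' => ?_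
    have hc0 := continuousAt_cavgIter_chart (d := d) (n := n) hL N k (ContinuousLinearMap.id ℝ (Matrix n n ℂ)) hU₀u hU₀P' hx hls hU₀x (boxVec N r) κ'
    have hcn : ContinuousAt (fun θ : TDir d n M =>
        ‖(((D₀ (boxVec N r) κ')⁻¹ : (Matrix n n ℂ)ˣ) : Matrix n n ℂ)
          * ((cavgIter L (k + 1) (chart (ContinuousLinearMap.id ℝ (Matrix n n ℂ)) M U₀ θ) (boxVec N r) κ' : (Matrix n n ℂ)ˣ) : Matrix n n ℂ) - 1‖) 0 :=
      ((continuousAt_const.mul hc0).sub continuousAt_const).norm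
    have h0 : ‖(((D₀ (boxVec N r) κ')⁻¹ : (Matrix n n ℂ)ˣ) : Matrix n n ℂ)
        * ((cavgIter L (k + 1) (chart (ContinuousLinearMap.id ℝ (Matrix n n ℂ)) M U₀ 0) (boxVec N r) κ' : (Matrix n n ℂ)ˣ) : Matrix n n ℂ) - 1‖ < 1 / 4 := by
      rw [chart_zero, hcD, Units.inv_mul, sub_self, norm_zero]
      norm_num
    exact (hcn.eventually (gt_mem_nhds h0)).mono fun θ hθ => hθ.le
  have hV3 : ∀ᶠ Φ : ↥(skewSub d n M) in 𝓝 0, ∀ (r : Fin d → Fin N) (κ' : Fin d),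
      ‖(((D₀ (boxVec N r) κ')⁻¹ : (Matrix n n ℂ)ˣ) : Matrix n n ℂ) * (cavgIter L (k + 1) (ch Φ) (boxVec N r) κ' : Matrix n n ℂ) - 1‖ ≤ 1 / 4 :=
    hval0.eventually hV3'
  -- a closed ball of radius `4ρ₀` inside all the good sets
  obtain ⟨r₀, hr₀, hball⟩ : ∃ r₀ > 0, closedBall (0 : ↥(skewSub d n M)) r₀ ⊆ s ∩ t ∩ {Φ | SmallField (ch Φ) x ∧ ∀ (r : Fin d → Fin N) (κ' : Fin d),
      ‖(((D₀ (boxVec N r) κ')⁻¹ : (Matrix n n ℂ)ˣ) : Matrix n n ℂ) * (cavgIter L (k + 1) (ch Φ) (boxVec N r) κ' : Matrix n n ℂ) - 1‖ ≤ 1 / 4} := by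
    have hmem : s ∩ t ∩ {Φ | SmallField (ch Φ) x ∧ ∀ (r : Fin d → Fin N) (κ' : Fin d),
        ‖(((D₀ (boxVec N r) κ')⁻¹ : (Matrix n n ℂ)ˣ) : Matrix n n ℂ) * (cavgIter L (k + 1) (ch Φ) (boxVec N r) κ' : Matrix n n ℂ) - 1‖ ≤ 1 / 4}
        ∈ 𝓝 (0 : ↥(skewSub d n M)) := inter_mem (inter_mem hs ht) (hV2.and hV3)
    obtain ⟨r, hr, hrsub⟩ := Metric.mem_nhds_iff.mp hmem
    exact ⟨r / 2, by positivity, (closedBall_subset_ball (by linarith)).trans hrsub⟩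
  refine ⟨κ, K, ‖f'‖ + c, r₀ / 2, hκ, K.2, by positivity, by positivity, fun b hb => ⟨?_, ?_⟩⟩
  · -- (i) the coordinate of the average is Lipschitz at the centre
    have hbs : b ∈ s := (hball (mem_closedBall.mpr (by rw [dist_zero_right]; linarith))).1.1
    have h0s : (0 : ↥(skewSub d n M)) ∈ s := (hball (mem_closedBall_self hr₀.le)).1.1
    have h := happ b hbs 0 h0s
    rw [hg0, sub_zero, sub_zero] at h
    have h2 : ‖f' b‖ ≤ ‖f'‖ * ‖b‖ := f'.le_opNorm b
    calc ‖g b‖ = ‖(g b - f' b) + f' b‖ := by rw [sub_add_cancel]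
      _ ≤ ‖g b - f' b‖ + ‖f' b‖ := norm_add_le _ _
      _ ≤ c * ‖b‖ + ‖f'‖ * ‖b‖ := add_le_add h h2
      _ = (‖f'‖ + c) * ‖b‖ := by ring
  · intro D hDu hDP hDnear hy
    set y : ↥(skewSub d n N) := skewPR N (relLog N D₀ D) with hydef
    -- the radius and the surjectivity on the closed ball about `b`
    set ρ : ℝ := ‖y - g b‖ / κ with hρ
    have hρ0 : 0 ≤ ρ := by positivity
    have hρle : ρ ≤ r₀ / 2 := by
      rw [hρ, div_le_iff₀ hκ]; linarith [mul_comm κ (r₀ / 2)]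
    have hsub' : closedBall b ρ ⊆ closedBall (0 : ↥(skewSub d n M)) r₀ := by
      intro Φ hΦ
      rw [mem_closedBall, dist_zero_right]
      have h1 : dist Φ b ≤ ρ := mem_closedBall.mp hΦ
      have h2 : ‖Φ‖ ≤ ‖Φ - b‖ + ‖b‖ := norm_le_norm_sub_add Φ b
      rw [← dist_eq_norm] at h2
      linarith
    have hsub : closedBall b ρ ⊆ s := fun Φ hΦ => (hball (hsub' hΦ)).1.1
    have hsurj := happ.surjOn_closedBall_of_nonlinearRightInverse f'symm hρ0 hsub
    have hyball : y ∈ closedBall (g b) (((f'symm.nnnorm : ℝ)⁻¹ - c) * ρ) := by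
      rw [mem_closedBall, dist_eq_norm]
      show ‖y - g b‖ ≤ κ * ρ
      rw [hρ, mul_div_cancel₀ _ hκ.ne']
    obtain ⟨Φ, hΦball, hgΦ⟩ := hsurj hyball
    have hΦρ : ‖Φ - b‖ ≤ ρ := by rw [← dist_eq_norm]; exact mem_closedBall.mp hΦball
    have hΦgood := hball (hsub' hΦball)
    obtain ⟨⟨-, hΦt⟩, hΦx, hΦnear⟩ := hΦgood
    have hbt : b ∈ t := (hball (mem_closedBall.mpr (by rw [dist_zero_right]; linarith))).1.2
    refine ⟨Φ, hΦρ, ?_, ?_⟩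
    · -- admissibility over `D`: class membership and decoding of the top average
      have hΦs : (Φ : TDir d n M) ∈ skewSub d n M := Φ.2
      have hchu : IsUnitaryCfg (ch Φ) := by
        show IsUnitaryCfg (chart (ContinuousLinearMap.id ℝ (Matrix n n ℂ)) M U₀ (Φ : TDir d n M))
        rw [chart_id_eq_chart_skewP U₀ hΦs]
        exact isUnitaryCfg_chart M hU₀u _
      have hchP : IsPeriodicCfg (ch Φ) ((N * L ^ (k + 1) : ℕ) : ℤ) := by
        rw [ePM]
        exact isPeriodicCfg_chart (ContinuousLinearMap.id ℝ (Matrix n n ℂ)) M hU₀PM _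
      have hmem : ch Φ ∈ sfClass d L N ε (k + 1) := ⟨hchu, hchP, hΦx⟩
      refine ⟨hmem, ?_⟩
      have hchPt : IsPeriodicCfg (ch Φ) ((tower L N (k + 1) : ℕ) : ℤ) := by
        rw [natCast_tower_succ, ← eP]; exact hchP
      obtain ⟨hXu, -, -⟩ := cavgIter_unitary_small hL k hchu hx hls hΦx
      have hXP : IsPeriodicCfg (cavgIter L (k + 1) (ch Φ)) (N : ℤ) := isPeriodicCfg_cavgIter L N (k + 1) hchPt
      have hQ' : skewPR N (relLog N (cavgIter L (k + 1) U₀) (cavgIter L (k + 1) (ch Φ))) = skewPR N (relLog N D₀ D) := hgΦ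
      rw [hcD] at hQ'
      have heq : cavgIter L (k + 1) (ch Φ) = D := eq_of_skewPR_relLog_eq hXP hDP hD₀u hXu hDu hΦnear hDnear hQ'
      rw [← cavgIter_eq_avgIter]
      exact heq
    · -- the action along the chart is Lipschitz on `t`
      have h := hLip.dist_le_mul Φ hΦt b hbt
      rw [Real.dist_eq, dist_eq_norm] at h
      exact h

end

end Summit.QuantumFields.BalabanUV.T4Continuum.NE7AdmissibleFibreQuantitativeBase
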